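import Mathlib

/-!
# T40a — The Blaschke distance inequality (Hardy-space pricing of exponential sums)

For a finite set `{λ₀} ∪ Λ` of points in the right half-plane and coefficients `d`, the
exponential sum `E(u) = Σ_λ d_λ e^{-λ u}` (`u ≥ 0`) satisfies
  `∫₀^∞ |E(u)|² du ≥ |d_{λ₀}|² · |B_Λ(λ₀)|² / (2 Re λ₀)`,
`B_Λ(z) = Π_{λ ∈ Λ} (z - λ)/(z + conj λ)` the Blaschke product of the companions (the classical
distance formula of Müntz–Szász / Malmquist–Takenaka).  We prove it with an explicit dual vector
read off the Lagrange (partial-fraction) expansion of `B_Λ(z)/(z + conj λ₀)` and Cauchy–Schwarz.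
Consequently, if `|E(u)| ≤ M e^{-σ u}` for `u > 0` then
  `|d_{λ₀}|² |B_Λ(λ₀)|² / (2 Re λ₀) ≤ M² / (2σ)`:
a leading term is hidden by companions only at the price `log (1/|B_Λ(λ₀)|)`, whatever their
number and their coefficients.
-/

noncomputable section

open Real Complex Set MeasureTheory Finset Polynomial
open scoped ComplexConjugate

namespace Summit.RiemannHypothesis.RiemannHypothesis.Theorems

/-- Blaschke product of the finite set `Λ` (right half-plane) evaluated at `z`. -/
def blaschke (Λ : Finset ℂ) (z : ℂ) : ℂ := ∏ l ∈ Λ, (z - l) / (z + conj l)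

/-- The Gram form of the exponentials `e^{-λ u}` in `L²(0, ∞)`:
`S(c, d) = Σ_{λ, μ} c_λ conj(d_μ) / (λ + conj μ)`. -/
def gramForm (s : Finset ℂ) (c d : ℂ → ℂ) : ℂ :=
  ∑ l ∈ s, ∑ m ∈ s, c l * conj (d m) / (l + conj m)

/-- The exponential sum `E(u) = Σ_{λ ∈ s} d_λ e^{-λ u}`. -/
def expSum (s : Finset ℂ) (d : ℂ → ℂ) (u : ℝ) : ℂ := ∑ l ∈ s, d l * cexp (-(l * u))

/-- Dual coefficients: `r_i = N(-conj i) · w_i`, `N = Π_{λ∈Λ} (X - λ)`, `w_i` the nodal weight of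
the nodes `-conj j`, `j ∈ {λ₀} ∪ Λ` (partial fractions of `N(z)/Π_j (z + conj j)`). -/
def dualCoeff (Λ : Finset ℂ) (l₀ : ℂ) (i : ℂ) : ℂ :=
  (Lagrange.nodal Λ id).eval (-conj i) * Lagrange.nodalWeight (insert l₀ Λ) (fun l ↦ -conj l) i

/-- `l ↦ -conj l` is injective. -/
theorem injOn_neg_conj (S : Set ℂ) : Set.InjOn (fun l : ℂ ↦ -conj l) S := by
  intro a _ b _ h
  have h' : conj a = conj b := neg_injective h
  simpa using congrArg conj h'

/-- `z + conj w ≠ 0` for `z, w` in the open right half-plane. -/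
theorem add_conj_ne_zero {z w : ℂ} (hz : 0 < z.re) (hw : 0 < w.re) : z + conj w ≠ 0 := by
  intro h
  have := congrArg Complex.re h
  simp at this
  linarith

/-- **Partial fractions.** Off the nodes,
`Σ_i r_i / (z + conj i) = Π_{λ∈Λ}(z - λ) / Π_{i ∈ {λ₀}∪Λ} (z + conj i)`. -/
theorem sum_dualCoeff_div (Λ : Finset ℂ) {l₀ : ℂ} (hl₀ : l₀ ∉ Λ) {z : ℂ}
    (hz : ∀ i ∈ insert l₀ Λ, z + conj i ≠ 0) :
    ∑ i ∈ insert l₀ Λ, dualCoeff Λ l₀ i / (z + conj i) =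
      (∏ l ∈ Λ, (z - l)) / ∏ i ∈ insert l₀ Λ, (z + conj i) := by
  classical
  have hvs : Set.InjOn (fun l : ℂ ↦ -conj l) ((insert l₀ Λ : Finset ℂ) : Set ℂ) :=
    injOn_neg_conj _
  have hdeg : (Lagrange.nodal Λ id).degree < #(insert l₀ Λ) := by
    rw [Lagrange.degree_nodal, Finset.card_insert_of_notMem hl₀]
    exact_mod_cast Nat.lt_succ_self _
  have hinterp := Lagrange.eq_interpolate (f := Lagrange.nodal Λ id) hvs hdeg
  have heval : (Lagrange.nodal Λ id).eval z =
      ∑ i ∈ insert l₀ Λ, (Lagrange.nodal Λ id).eval (-conj i) *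
        ((Lagrange.nodal (insert l₀ Λ) (fun l ↦ -conj l)).eval z *
          (Lagrange.nodalWeight (insert l₀ Λ) (fun l ↦ -conj l) i * (z - -conj i)⁻¹)) := by
    conv_lhs => rw [hinterp]
    rw [Lagrange.interpolate_apply, Polynomial.eval_finsetSum]
    refine Finset.sum_congr rfl fun i hi ↦ ?_
    have hzi : z ≠ -conj i := fun h ↦ hz i hi (by rw [h]; ring)
    rw [Polynomial.eval_mul, Polynomial.eval_C, Lagrange.eval_basis_not_at_node hi hzi]
  have hD : (Lagrange.nodal (insert l₀ Λ) (fun l ↦ -conj l)).eval z =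
      ∏ i ∈ insert l₀ Λ, (z + conj i) := by
    rw [Lagrange.eval_nodal]
    exact Finset.prod_congr rfl fun i _ ↦ by ring
  have hDne : ∏ i ∈ insert l₀ Λ, (z + conj i) ≠ 0 := Finset.prod_ne_zero_iff.mpr hz
  have hNz : (Lagrange.nodal Λ id).eval z = ∏ l ∈ Λ, (z - l) := by
    rw [Lagrange.eval_nodal]; rfl
  rw [eq_div_iff hDne, ← hNz, heval, Finset.sum_mul]
  refine Finset.sum_congr rfl fun i hi ↦ ?_
  rw [hD, dualCoeff, sub_neg_eq_add, div_eq_mul_inv]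
  have hzi : z + conj i ≠ 0 := hz i hi
  field_simp

/-- At a companion `k ∈ Λ` the dual sum vanishes. -/
theorem sum_dualCoeff_div_of_mem (Λ : Finset ℂ) {l₀ : ℂ} (hl₀ : l₀ ∉ Λ)
    (hpos : ∀ l ∈ insert l₀ Λ, 0 < l.re) {k : ℂ} (hk : k ∈ Λ) :
    ∑ i ∈ insert l₀ Λ, dualCoeff Λ l₀ i / (k + conj i) = 0 := by
  have hkpos : 0 < k.re := hpos k (Finset.mem_insert_of_mem hk)
  rw [sum_dualCoeff_div Λ hl₀ (fun i hi ↦ add_conj_ne_zero hkpos (hpos i hi)),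
    Finset.prod_eq_zero hk (sub_self k), zero_div]

/-- At the leading point the dual sum equals `B_Λ(λ₀)/(λ₀ + conj λ₀)`. -/
theorem sum_dualCoeff_div_self (Λ : Finset ℂ) {l₀ : ℂ} (hl₀ : l₀ ∉ Λ)
    (hpos : ∀ l ∈ insert l₀ Λ, 0 < l.re) :
    ∑ i ∈ insert l₀ Λ, dualCoeff Λ l₀ i / (l₀ + conj i) =
      blaschke Λ l₀ / (l₀ + conj l₀) := by
  have h0 : 0 < l₀.re := hpos l₀ (Finset.mem_insert_self _ _)
  rw [sum_dualCoeff_div Λ hl₀ (fun i hi ↦ add_conj_ne_zero h0 (hpos i hi)),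
    Finset.prod_insert hl₀, blaschke, Finset.prod_div_distrib, div_div]
  ring

/-- `r_{λ₀} · conj B_Λ(λ₀) = 1`. -/
theorem dualCoeff_self_mul_conj_blaschke (Λ : Finset ℂ) {l₀ : ℂ} (hl₀ : l₀ ∉ Λ)
    (hpos : ∀ l ∈ insert l₀ Λ, 0 < l.re) :
    dualCoeff Λ l₀ l₀ * conj (blaschke Λ l₀) = 1 := by
  classical
  have h0 : 0 < l₀.re := hpos l₀ (Finset.mem_insert_self _ _)
  rw [dualCoeff, Lagrange.eval_nodal, Lagrange.nodalWeight, Finset.erase_insert hl₀, blaschke,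
    map_prod, ← Finset.prod_mul_distrib, ← Finset.prod_mul_distrib]
  refine Finset.prod_eq_one fun l hl ↦ ?_
  have h1 : conj l₀ + l ≠ 0 := by
    have := add_conj_ne_zero (hpos l (Finset.mem_insert_of_mem hl)) h0
    rwa [add_comm] at this
  have hne : l ≠ l₀ := fun h ↦ hl₀ (h ▸ hl)
  have h2 : -conj l₀ - -conj l ≠ 0 := by
    rw [sub_ne_zero]
    intro h
    exact hne.symm (by simpa using congrArg conj (neg_injective h))
  have h3 : conj l₀ + conj (conj l) ≠ 0 := by rwa [Complex.conj_conj]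
  simp only [id, map_div₀, map_sub, map_add, Complex.conj_conj]
  rw [Complex.conj_conj] at h3
  field_simp
  ring

/-- Hermitian symmetry of the Gram form. -/
theorem gramForm_conj_symm (s : Finset ℂ) (c d : ℂ → ℂ) :
    gramForm s d c = conj (gramForm s c d) := by
  simp only [gramForm, map_sum, map_div₀, map_mul, map_add, Complex.conj_conj]
  rw [Finset.sum_comm]
  exact Finset.sum_congr rfl fun y _ ↦ Finset.sum_congr rfl fun x _ ↦ by ring

/-- Expansion of `S(c - t e, c - t e)`. -/
theorem gramForm_sub_smul (s : Finset ℂ) (c e : ℂ → ℂ) (t : ℂ) :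
    gramForm s (fun l ↦ c l - t * e l) (fun l ↦ c l - t * e l) =
      gramForm s c c - conj t * gramForm s c e - t * gramForm s e c +
        t * conj t * gramForm s e e := by
  have key : ∀ l m : ℂ, (c l - t * e l) * conj (c m - t * e m) / (l + conj m) =
      c l * conj (c m) / (l + conj m) - conj t * (c l * conj (e m) / (l + conj m)) -
        t * (e l * conj (c m) / (l + conj m)) + t * conj t * (e l * conj (e m) / (l + conj m)) := by
    intro l m
    simp only [map_sub, map_mul]
    ring
  simp only [gramForm, key, Finset.sum_add_distrib, Finset.sum_sub_distrib, ← Finset.mul_sum]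

/-- **The algebraic core.** If the Gram form is positive semidefinite on `{λ₀} ∪ Λ` then
`S(c, c) ≥ |c_{λ₀}|² |B_Λ(λ₀)|² / (2 Re λ₀)`. -/
theorem gram_lower_bound (Λ : Finset ℂ) {l₀ : ℂ} (hl₀ : l₀ ∉ Λ)
    (hpos : ∀ l ∈ insert l₀ Λ, 0 < l.re) (c : ℂ → ℂ)
    (hnn : ∀ d : ℂ → ℂ, 0 ≤ (gramForm (insert l₀ Λ) d d).re) :
    ‖c l₀‖ ^ 2 * ‖blaschke Λ l₀‖ ^ 2 / (2 * l₀.re) ≤ (gramForm (insert l₀ Λ) c c).re := by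
  classical
  have h0 : 0 < l₀.re := hpos l₀ (Finset.mem_insert_self _ _)
  set B := blaschke Λ l₀ with hB
  set β : ℂ := B / (l₀ + conj l₀) with hβ
  set e : ℂ → ℂ := fun m ↦ conj (dualCoeff Λ l₀ m) with he
  have hD : l₀ + conj l₀ = ((2 * l₀.re : ℝ) : ℂ) := Complex.add_conj l₀
  have hDpos : (0 : ℝ) < 2 * l₀.re := by positivity
  have hDne : ((2 * l₀.re : ℝ) : ℂ) ≠ 0 := by exact_mod_cast hDpos.ne'
  -- values of the dual sums
  have hR : ∀ l ∈ insert l₀ Λ, ∑ m ∈ insert l₀ Λ, dualCoeff Λ l₀ m / (l + conj m) =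
      if l = l₀ then β else 0 := by
    intro l hl
    rcases Finset.mem_insert.mp hl with rfl | hl'
    · rw [if_pos rfl, hβ, hB, sum_dualCoeff_div_self Λ hl₀ hpos]
    · have hne : l ≠ l₀ := fun h ↦ hl₀ (h ▸ hl')
      rw [if_neg hne, sum_dualCoeff_div_of_mem Λ hl₀ hpos hl']
  have hpair : ∀ f : ℂ → ℂ, gramForm (insert l₀ Λ) f e = f l₀ * β := by
    intro f
    have h1 : ∀ l ∈ insert l₀ Λ, ∑ m ∈ insert l₀ Λ, f l * conj (e m) / (l + conj m) =
        f l * (if l = l₀ then β else 0) := by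
      intro l hl
      rw [← hR l hl, Finset.mul_sum]
      exact Finset.sum_congr rfl fun m _ ↦ by simp only [he, Complex.conj_conj]; ring
    rw [gramForm, Finset.sum_congr rfl h1]
    simp only [mul_ite, mul_zero, Finset.sum_ite_eq', Finset.mem_insert_self, if_true]
  have hce : gramForm (insert l₀ Λ) c e = c l₀ * β := hpair c
  have hec : gramForm (insert l₀ Λ) e c = conj (c l₀ * β) := by rw [gramForm_conj_symm, hce]
  have hee : gramForm (insert l₀ Λ) e e = 1 / (l₀ + conj l₀) := by
    rw [hpair e, he]
    have h1 := congrArg conj (dualCoeff_self_mul_conj_blaschke Λ hl₀ hpos)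
    rw [map_mul, Complex.conj_conj, map_one] at h1
    simp only [hβ]
    rw [← mul_div_assoc, h1]
  -- Cauchy–Schwarz with the optimal multiple of the dual vector
  set w : ℂ := c l₀ * β with hw
  set t : ℂ := ((2 * l₀.re : ℝ) : ℂ) * w with ht
  have hnn' := hnn (fun l ↦ c l - t * e l)
  rw [gramForm_sub_smul, hce, hec, hee, hD] at hnn'
  have key : gramForm (insert l₀ Λ) c c - conj t * w - t * conj w + t * conj t * (1 / ((2 * l₀.re : ℝ) : ℂ)) =
      gramForm (insert l₀ Λ) c c - ((2 * l₀.re : ℝ) : ℂ) * (w * conj w) := by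
    rw [ht, map_mul, Complex.conj_ofReal]
    field_simp
    ring
  rw [key, Complex.sub_re, Complex.mul_conj, ← Complex.ofReal_mul, Complex.ofReal_re,
    Complex.normSq_eq_norm_sq] at hnn'
  -- ‖w‖ = ‖c l₀‖ ‖B‖ / (2 Re l₀)
  have hnw : ‖w‖ = ‖c l₀‖ * ‖B‖ / (2 * l₀.re) := by
    rw [hw, hβ, norm_mul, norm_div, hD, Complex.norm_real, Real.norm_of_nonneg hDpos.le,
      mul_div_assoc]
  rw [hnw] at hnn'
  have : ‖c l₀‖ ^ 2 * ‖B‖ ^ 2 / (2 * l₀.re) =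
      2 * l₀.re * (‖c l₀‖ * ‖B‖ / (2 * l₀.re)) ^ 2 := by
    field_simp
  rw [this]
  linarith

/-! ## The analytic input: the Gram form is an `L²(0, ∞)` norm -/

/-- `|E(u)|²` expanded as a double sum. -/
theorem ofReal_norm_sq_expSum (s : Finset ℂ) (d : ℂ → ℂ) (u : ℝ) :
    ((‖expSum s d u‖ ^ 2 : ℝ) : ℂ) =
      ∑ l ∈ s, ∑ m ∈ s, d l * conj (d m) * cexp (-(l + conj m) * u) := by
  rw [← Complex.normSq_eq_norm_sq, ← Complex.mul_conj, expSum, map_sum, Finset.sum_mul_sum]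
  refine Finset.sum_congr rfl fun l _ ↦ Finset.sum_congr rfl fun m _ ↦ ?_
  rw [map_mul, ← Complex.exp_conj, map_neg, map_mul, Complex.conj_ofReal,
    show -(l + conj m) * (u : ℂ) = -(l * u) + -(conj m * u) by ring, Complex.exp_add]
  ring

/-- Each term of the double sum is integrable on `(0, ∞)`. -/
theorem integrable_expSum_term (s : Finset ℂ) (hpos : ∀ l ∈ s, 0 < l.re) (d : ℂ → ℂ)
    {l m : ℂ} (hl : l ∈ s) (hm : m ∈ s) :
    Integrable (fun u : ℝ ↦ d l * conj (d m) * cexp (-(l + conj m) * u))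
      (volume.restrict (Ioi 0)) := by
  have hre : (-(l + conj m)).re < 0 := by
    simp only [Complex.neg_re, Complex.add_re, Complex.conj_re]
    linarith [hpos l hl, hpos m hm]
  exact (integrableOn_exp_mul_complex_Ioi hre 0).const_mul _

/-- **`S(d, d) = ∫₀^∞ |E(u)|² du`.** -/
theorem gramForm_eq_integral (s : Finset ℂ) (hpos : ∀ l ∈ s, 0 < l.re) (d : ℂ → ℂ) :
    gramForm s d d = ∫ u in Ioi (0 : ℝ), ((‖expSum s d u‖ ^ 2 : ℝ) : ℂ) := by
  simp_rw [ofReal_norm_sq_expSum]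
  rw [integral_finsetSum _ (fun l hl ↦ integrable_finsetSum _
    (fun m hm ↦ integrable_expSum_term s hpos d hl hm))]
  refine Finset.sum_congr rfl fun l hl ↦ ?_
  rw [integral_finsetSum _ (fun m hm ↦ integrable_expSum_term s hpos d hl hm)]
  refine Finset.sum_congr rfl fun m hm ↦ ?_
  have hre : (-(l + conj m)).re < 0 := by
    simp only [Complex.neg_re, Complex.add_re, Complex.conj_re]
    linarith [hpos l hl, hpos m hm]
  have hne : l + conj m ≠ 0 := add_conj_ne_zero (hpos l hl) (hpos m hm)
  rw [integral_const_mul, integral_exp_mul_complex_Ioi hre 0]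
  simp only [Complex.ofReal_zero, mul_zero, Complex.exp_zero]
  field_simp

/-- `|E|²` is integrable on `(0, ∞)`. -/
theorem integrable_norm_sq_expSum (s : Finset ℂ) (hpos : ∀ l ∈ s, 0 < l.re) (d : ℂ → ℂ) :
    Integrable (fun u : ℝ ↦ ‖expSum s d u‖ ^ 2) (volume.restrict (Ioi 0)) := by
  have hC : Integrable (fun u : ℝ ↦ ((‖expSum s d u‖ ^ 2 : ℝ) : ℂ)) (volume.restrict (Ioi 0)) := by
    simp_rw [ofReal_norm_sq_expSum]
    exact integrable_finsetSum _ (fun l hl ↦ integrable_finsetSum _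
      (fun m hm ↦ integrable_expSum_term s hpos d hl hm))
  exact hC.re.congr (ae_of_all _ fun u ↦ by simp only [RCLike.re_to_complex, Complex.ofReal_re])

/-- Positivity of the Gram form. -/
theorem gramForm_re_nonneg (s : Finset ℂ) (hpos : ∀ l ∈ s, 0 < l.re) (d : ℂ → ℂ) :
    0 ≤ (gramForm s d d).re := by
  rw [gramForm_eq_integral s hpos d, integral_complex_ofReal, Complex.ofReal_re]
  exact integral_nonneg fun u ↦ by positivity

/-- An exponentially decaying sup bound controls the Gram form. -/
theorem gramForm_re_le (s : Finset ℂ) (hpos : ∀ l ∈ s, 0 < l.re) (d : ℂ → ℂ) {M σ : ℝ}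
    (hσ : 0 < σ) (hbound : ∀ u : ℝ, 0 < u → ‖expSum s d u‖ ≤ M * Real.exp (-σ * u)) :
    (gramForm s d d).re ≤ M ^ 2 / (2 * σ) := by
  rw [gramForm_eq_integral s hpos d, integral_complex_ofReal, Complex.ofReal_re]
  have h1 : ∫ u in Ioi (0 : ℝ), ‖expSum s d u‖ ^ 2 ≤
      ∫ u in Ioi (0 : ℝ), M ^ 2 * Real.exp (-(2 * σ) * u) := by
    refine setIntegral_mono_on (integrable_norm_sq_expSum s hpos d)
      ((integrableOn_exp_mul_Ioi (by linarith) 0).const_mul _) measurableSet_Ioi ?_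
    intro u hu
    have hb := hbound u hu
    have : M ^ 2 * Real.exp (-(2 * σ) * u) = (M * Real.exp (-σ * u)) ^ 2 := by
      rw [mul_pow, sq (Real.exp _), ← Real.exp_add]
      ring_nf
    rw [this]
    exact pow_le_pow_left₀ (norm_nonneg _) hb 2
  have h2 : ∫ u in Ioi (0 : ℝ), M ^ 2 * Real.exp (-(2 * σ) * u) = M ^ 2 / (2 * σ) := by
    rw [integral_const_mul, integral_exp_mul_Ioi (by linarith) 0]
    simp only [mul_zero, Real.exp_zero]
    field_simp
  linarith

/-- **T40a (Blaschke pricing of an exponential sum).**  If `|Σ_λ d_λ e^{-λu}| ≤ M e^{-σu}` on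
`u > 0` then `|d_{λ₀}|² |B_Λ(λ₀)|² / (2 Re λ₀) ≤ M² / (2σ)`. -/
theorem blaschke_lower_bound (Λ : Finset ℂ) {l₀ : ℂ} (hl₀ : l₀ ∉ Λ)
    (hpos : ∀ l ∈ insert l₀ Λ, 0 < l.re) (d : ℂ → ℂ) {M σ : ℝ} (hσ : 0 < σ)
    (hbound : ∀ u : ℝ, 0 < u → ‖expSum (insert l₀ Λ) d u‖ ≤ M * Real.exp (-σ * u)) :
    ‖d l₀‖ ^ 2 * ‖blaschke Λ l₀‖ ^ 2 / (2 * l₀.re) ≤ M ^ 2 / (2 * σ) :=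
  (gram_lower_bound Λ hl₀ hpos d (fun d' ↦ gramForm_re_nonneg _ hpos d')).trans
    (gramForm_re_le _ hpos d hσ hbound)

end Summit.RiemannHypothesis.RiemannHypothesis.Theorems
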